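import Literature.AlgebraicGeometry.Frobenioids.ArithmeticRealificationCoordQ
import Literature.AnabelianGeometry.EtaleTheta.RealificationUniversal
import Literature.AlgebraicGeometry.Frobenioids.RealificationDataCanonical
import Literature.AlgebraicGeometry.Frobenioids.RealPowNNRealLinear
import HarnessLib

/-!
# Frobenioids I, Thm. 6.4 (i): the coordinates `(Φ^rlf)^gp(L) = ArithDiv_ℝ(L)` of THE realification of the
# arithmetic divisor monoid `Φ(L)`

Mochizuki, *The geometry of Frobenioids I*, Kyushu J. Math. **62** (2008), Thm. 6.4 (i), proof p. 115 l. 27–33: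
"the homomorphism `(Φ^rlf)^gp(L) = ArithDiv_ℝ(L) → ℝ` given by `deg_L^arith` … the image via the natural map
`Φ^birat(L) → Φ^rlf(L)` of `Φ^birat(L) ⊗_ℤ ℝ` in `(Φ^rlf_factor)^gp(L)` is equal to the set of elements of finite
support with arithmetic degree `0`" [cite: MochizukiFrdI2008, Thm. 6.4 (i) p.115]; Def. 2.4 (i) p. 48 (the
realification `M^rlf ⊆ M^rlf_factor = ∏_𝔭 M^rlf_𝔭`, an `ℝ_{≥0}`-semimodule with `(M^rlf)^gp` an `ℝ`-vector space)
[cite: MochizukiFrdI2008, Def. 2.4(i) p.48]; the universal property of `M^pf → M^rlf` among monoids supported by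
`ℝ` is [EtTh] Lem. 3.5 (i) p. 75 (tree: abc-iut-L2-d2 `RlfUniversal.existsUnique_lift`) [cite: MochizukiEtTh2009, Lem 3.5 p.75].

PROOF-ONLY (node FrdI:Thm6.4(i), sub-DAG row T64i/L15 interface level; seat abc-iut-L1-d2, cell abc-iut).
PART 2 of 2 (part 1 = `ArithmeticRealificationCoordQ.lean`: the coordinate embedding `j : Φ(L) → ⊕_v ℝ_{≥0}` and its
perfection).  For a number field `L` and THE realification `Φ(L)^rlf = IsPerfFactorial.Rlf` of the perf-factorial monoid
`Φ(L) = Multiplicative (EffArithDivisor L)` (`EffArithDivisor.isPerfFactorial`, Ex. 6.3), this file PROVES the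
identification of print, `(Φ^rlf)^gp(L) = ArithDiv_ℝ(L)`, in the following usable form
(`ArithRlfCoord.exists_rlfGp_coordinates`): there is an INJECTIVE homomorphism

  `Θ : (Φ(L)^rlf)^gp → ADiv_ℝ(L) = Place L →₀ ℝ` (abc-iut-S's `Literature.IUT.LogVolume.ADivisor L`)

which (a) restricted along `ι : Φ(L) → Φ(L)^rlf` IS the comparison `Φ(L)^gp = ArithDivisor L → ADiv_ℝ(L)` of
`ArithmeticDivisorsFrdBridge` (`ADivisor.ofArithDivisor`, so principal divisors go to principal divisors and
`deg^arith` to `deg_L`), (b) maps `Φ(L)^rlf` to EFFECTIVE real divisors, and (c) is `ℝ`-LINEAR for the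
`ℝ`-vector-space structure `IsPerfFactorial.Rlf.realSMul` of Def. 2.4 (i) (`RealificationDataCanonical`).
Construction: `Q := ⊕_{v ∈ Place L} ℝ_{≥0}` (`directSum`) is supported by `ℝ`
(`DirectSum.supports_R_of_isRMonoprime`, abc-iut-w4-d015); the coordinate embedding `j : Φ(L) → Q`
(`[L_w:ℝ]·t_w` at archimedean `w`, `n_v` at finite `v`) extends to `Φ(L)^pf → Q` (injective, image = the families
with RATIONAL finite coordinates, group-saturated) and then UNIQUELY to `θ : Φ(L)^rlf → Q`
(`RlfUniversal.existsUnique_lift`), injective by order reflection (`RlfUniversal.lift_injective`) and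
`ℝ_{≥0}`-equivariant coordinatewise (`IsPerfFactorial.Rlf.hom_nnreal_rpow`); `Θ := (Q ⊆ ADiv_ℝ(L))^gp ∘ θ^gp`.
All intermediate objects are hypotheses of the helper theorems (characterised by their coordinates), so that no
definition is introduced.  The same route was taken for the one-arrow model of [IUTchIII] Prop. 3.7 by
abc-iut-w4-d015 (`Literature.IUT.LogThetaLattice.Prop37.rlfEquivModel`); here the number field and the target
`ADiv_ℝ(L)` are those of [FrdI] Thm. 6.4 / abc-iut-L1-t3's sub-DAG rows T64i/L13–L15.
-/

noncomputable section

open scoped NNReal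

namespace Literature.AlgebraicGeometry.Frobenioids

namespace ArithRlfCoord

open Function NumberField IsDedekindDomain Literature.AnabelianGeometry.EtaleTheta Literature.IUT.LogVolume

variable {L : Type} [Field L] [NumberField L]

/-! ### THE homomorphism `θ : Φ(L)^rlf → Q` over `j^pf` (characterised by the universal property) -/

section Theta

variable {hM : IsPerfFactorial (Multiplicative (EffArithDivisor L))}
  (j : Multiplicative (EffArithDivisor L) →* directSum fun _ : Place L => Multiplicative ℝ≥0)
  (hj₁ : ∀ (D : EffArithDivisor L) (w : InfinitePlace L),
    Multiplicative.toAdd ((j (Multiplicative.ofAdd D) : Place L → Multiplicative ℝ≥0) (Sum.inl w)) =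
      (w.mult : ℝ≥0) * D.2 w)
  (hj₂ : ∀ (D : EffArithDivisor L) (v : HeightOneSpectrum (𝓞 L)),
    Multiplicative.toAdd ((j (Multiplicative.ofAdd D) : Place L → Multiplicative ℝ≥0) (Sum.inr v)) =
      ((D.1 (FinitePlace.mk v) : ℕ) : ℝ≥0))
  (θ : hM.Rlf →* directSum fun _ : Place L => Multiplicative ℝ≥0)
  (hθ : θ.comp hM.toRealification =
    (isPerfect_realDirectSum L).equivPerfection.symm.toMonoidHom.comp (Perfection.map j))

section
include hθ

/-- `θ (ι D) = j D` for `ι = (Φ(L) → Φ(L)^pf → Φ(L)^rlf)`. [cite: MochizukiFrdI2008, Def. 2.4(i) p.48] -/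
theorem theta_iota (D : Multiplicative (EffArithDivisor L)) :
    θ (hM.toRealification (Perfection.of _ D)) = j D := by
  have h := DFunLike.congr_fun hθ (Perfection.of _ D)
  rw [MonoidHom.comp_apply] at h
  rw [h]
  -- `j^pf ∘ of = j`
  show (isPerfect_realDirectSum L).equivPerfection.symm (Perfection.map j (Perfection.of _ D)) = _
  apply (isPerfect_realDirectSum L).equivPerfection.injective
  rw [MulEquiv.apply_symm_apply, IsPerfect.equivPerfection_apply]
  exact DFunLike.congr_fun (Perfection.map_comp_of j) D

end

/-- **`θ` is `ℝ_{≥0}`-equivariant coordinatewise**: `θ(a^r)_p = r · θ(a)_p` (every homomorphism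
`M^rlf → ℝ_{≥0}` is `ℝ_{≥0}`-linear, `IsPerfFactorial.Rlf.hom_nnreal_rpow`, applied to the `p`-th coordinate of
`θ`). [cite: MochizukiFrdI2008, Def. 2.4(i) p.48] -/
theorem toAdd_theta_rpow (r : ℝ≥0) (a : hM.Rlf) (p : Place L) :
    Multiplicative.toAdd ((θ (IsPerfFactorial.Rlf.rpow hM r a) : Place L → Multiplicative ℝ≥0) p) =
      r * Multiplicative.toAdd ((θ a : Place L → Multiplicative ℝ≥0) p) :=
  IsPerfFactorial.Rlf.hom_nnreal_rpow hM
    (((Pi.evalMonoidHom (fun _ : Place L => Multiplicative ℝ≥0) p).comp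
      (directSum fun _ : Place L => Multiplicative ℝ≥0).subtype).comp θ) r a

include hθ hj₁ hj₂

/-- **`θ` is injective** (order reflection of the universal extension, abc-iut-L2-d2
`RlfUniversal.lift_injective`: `j^pf` is injective with group-saturated image). [cite: MochizukiEtTh2009, Lem 3.5 p.76] -/
theorem theta_injective : Injective θ :=
  RlfUniversal.lift_injective hM _ (coordPf_injective j hj₁ hj₂) (isGroupSaturated_mrange_coordPf j hj₁ hj₂) θ hθ

end Theta

/-! ### Main theorem: the coordinates `Θ : (Φ(L)^rlf)^gp ↪ ADiv_ℝ(L)` -/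

/-- **`(Φ^rlf)^gp(L) = ArithDiv_ℝ(L)`** (Thm. 6.4 (i), proof p. 115 l. 27–33), as coordinates of THE realification:
for THE realification `Φ(L)^rlf` (Def. 2.4 (i)) of the perf-factorial monoid `Φ(L)` of effective arithmetic
divisors there is an injective homomorphism `Θ : (Φ(L)^rlf)^gp → ADiv_ℝ(L)` (`= Place L →₀ ℝ`) such that
(a) `Θ ∘ ι^gp` is the comparison `ArithDivisor L → ADiv_ℝ(L)` (`ADivisor.ofArithDivisor`: on `ι(D)`,
`D ∈ Φ(L)`, `Θ` is the real arithmetic divisor of `D`), (b) `Θ` maps `Φ(L)^rlf` to effective divisors, and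
(c) `Θ` is `ℝ`-linear for the `ℝ`-vector-space structure `realSMul` of `(Φ(L)^rlf)^gp`.
[cite: MochizukiFrdI2008, Thm. 6.4 (i) p.115] -/
theorem exists_rlfGp_coordinates (hM : IsPerfFactorial (Multiplicative (EffArithDivisor L))) :
    ∃ Θ : Algebra.GrothendieckGroup hM.Rlf →* Multiplicative (ADivisor L),
      Injective Θ ∧
      (∀ D : EffArithDivisor L,
        Θ (Algebra.GrothendieckGroup.of (hM.toRealification (Perfection.of _ (Multiplicative.ofAdd D)))) =
          Multiplicative.ofAdd (ADivisor.ofArithDivisor L (EffArithDivisor.toArithDivisor L D))) ∧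
      (∀ (a : hM.Rlf) (p : Place L), 0 ≤ Multiplicative.toAdd (Θ (Algebra.GrothendieckGroup.of a)) p) ∧
      (∀ (r : ℝ) (ξ : Algebra.GrothendieckGroup hM.Rlf),
        Θ (IsPerfFactorial.Rlf.realSMul hM r ξ) = Multiplicative.ofAdd (r • Multiplicative.toAdd (Θ ξ))) := by
  classical
  -- the coordinate embedding `j : Φ(L) → Q`
  let jfun : EffArithDivisor L → Place L → Multiplicative ℝ≥0 := fun D p =>
    Sum.elim (fun w : InfinitePlace L => Multiplicative.ofAdd ((w.mult : ℝ≥0) * D.2 w))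
      (fun v : HeightOneSpectrum (𝓞 L) => Multiplicative.ofAdd ((D.1 (FinitePlace.mk v) : ℕ) : ℝ≥0)) p
  have jfun_mem : ∀ D, jfun D ∈ directSum fun _ : Place L => Multiplicative ℝ≥0 := by
    intro D
    rw [DirectSum.mem_iff]
    refine ((Set.finite_range (Sum.inl : InfinitePlace L → Place L)).union
      ((D.1.support.finite_toSet.image fun w : FinitePlace L =>
        (Sum.inr (FinitePlace.maximalIdeal w) : Place L)))).subset ?_
    rintro (w | v) hp
    · exact Or.inl ⟨w, rfl⟩
    · refine Or.inr ⟨FinitePlace.mk v, ?_, by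
        show (Sum.inr (FinitePlace.maximalIdeal (FinitePlace.mk v)) : Place L) = Sum.inr v
        rw [FinitePlace.maximalIdeal_mk]⟩
      rw [Finset.mem_coe, Finsupp.mem_support_iff]
      intro h0
      apply hp
      show Multiplicative.ofAdd (((D.1 (FinitePlace.mk v) : ℕ) : ℝ≥0)) = 1
      rw [h0, Nat.cast_zero, ofAdd_zero]
  let j : Multiplicative (EffArithDivisor L) →* directSum fun _ : Place L => Multiplicative ℝ≥0 :=
    { toFun := fun D => ⟨jfun (Multiplicative.toAdd D), jfun_mem _⟩
      map_one' := by
        refine Subtype.ext (funext fun p => ?_)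
        rcases p with w | v
        · show Multiplicative.ofAdd ((w.mult : ℝ≥0) * (0 : EffArithDivisor L).2 w) = 1
          rw [Prod.snd_zero, Pi.zero_apply, mul_zero, ofAdd_zero]
        · show Multiplicative.ofAdd ((((0 : EffArithDivisor L).1 (FinitePlace.mk v) : ℕ) : ℝ≥0)) = 1
          rw [Prod.fst_zero, Finsupp.zero_apply, Nat.cast_zero, ofAdd_zero]
      map_mul' := fun D E => by
        refine Subtype.ext (funext fun p => ?_)
        rw [DirectSum.coe_mul, Pi.mul_apply]
        rcases p with w | v
        · show Multiplicative.ofAdd ((w.mult : ℝ≥0) * (Multiplicative.toAdd (D * E)).2 w) =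
            Multiplicative.ofAdd ((w.mult : ℝ≥0) * (Multiplicative.toAdd D).2 w) *
              Multiplicative.ofAdd ((w.mult : ℝ≥0) * (Multiplicative.toAdd E).2 w)
          rw [toAdd_mul, Prod.snd_add, Pi.add_apply, mul_add, ofAdd_add]
        · show Multiplicative.ofAdd ((((Multiplicative.toAdd (D * E)).1 (FinitePlace.mk v) : ℕ) : ℝ≥0)) =
            Multiplicative.ofAdd ((((Multiplicative.toAdd D).1 (FinitePlace.mk v) : ℕ) : ℝ≥0)) *
              Multiplicative.ofAdd ((((Multiplicative.toAdd E).1 (FinitePlace.mk v) : ℕ) : ℝ≥0))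
          rw [toAdd_mul, Prod.fst_add, Finsupp.add_apply, Nat.cast_add, ofAdd_add] }
  have hj₁ : ∀ (D : EffArithDivisor L) (w : InfinitePlace L),
      Multiplicative.toAdd ((j (Multiplicative.ofAdd D) : Place L → Multiplicative ℝ≥0) (Sum.inl w)) =
        (w.mult : ℝ≥0) * D.2 w := fun D w => rfl
  have hj₂ : ∀ (D : EffArithDivisor L) (v : HeightOneSpectrum (𝓞 L)),
      Multiplicative.toAdd ((j (Multiplicative.ofAdd D) : Place L → Multiplicative ℝ≥0) (Sum.inr v)) =
        ((D.1 (FinitePlace.mk v) : ℕ) : ℝ≥0) := fun D v => rfl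
  -- THE extension `θ : Φ(L)^rlf → Q` of `j^pf`
  obtain ⟨θ, hθ, -⟩ := RlfUniversal.existsUnique_lift hM (supports_R_realDirectSum L)
    ((isPerfect_realDirectSum L).equivPerfection.symm.toMonoidHom.comp (Perfection.map j))
  -- `κ : Q → ADiv_ℝ(L)`, the inclusion `⊕_v ℝ_{≥0} ⊆ ⊕_v ℝ`
  have κsupp : ∀ q : directSum (fun _ : Place L => Multiplicative ℝ≥0),
      (Function.support fun p : Place L =>
        ((Multiplicative.toAdd ((q : Place L → Multiplicative ℝ≥0) p) : ℝ≥0) : ℝ)).Finite := by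
    intro q
    refine (DirectSum.finite_dsupp q).subset fun p hp => ?_
    rw [Function.mem_support, ne_eq, NNReal.coe_eq_zero] at hp
    rw [mem_dsupp_iff]
    intro h1
    exact hp (by rw [h1, toAdd_one])
  let κ : (directSum fun _ : Place L => Multiplicative ℝ≥0) →* Multiplicative (ADivisor L) :=
    { toFun := fun q => Multiplicative.ofAdd (Finsupp.ofSupportFinite _ (κsupp q))
      map_one' := by
        rw [← ofAdd_zero]
        congr 1
        ext p
        rw [Finsupp.ofSupportFinite_coe, DirectSum.coe_one, Pi.one_apply, toAdd_one, NNReal.coe_zero,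
          Finsupp.zero_apply]
      map_mul' := fun x y => by
        rw [← ofAdd_add]
        congr 1
        ext p
        rw [Finsupp.ofSupportFinite_coe, Finsupp.add_apply, Finsupp.ofSupportFinite_coe,
          Finsupp.ofSupportFinite_coe, toAdd_coe_mul, NNReal.coe_add] }
  have κ_apply : ∀ (q : directSum fun _ : Place L => Multiplicative ℝ≥0) (p : Place L),
      Multiplicative.toAdd (κ q) p = ((Multiplicative.toAdd ((q : Place L → Multiplicative ℝ≥0) p) : ℝ≥0) : ℝ) :=
    fun q p => rfl
  have κ_injective : Injective κ := by
    intro x y hxy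
    refine Subtype.ext (funext fun p => ?_)
    apply Multiplicative.toAdd.injective
    apply NNReal.coe_injective
    rw [← κ_apply, ← κ_apply, hxy]
  -- `Θ := (κ ∘ θ)^gp`
  let Θ : Algebra.GrothendieckGroup hM.Rlf →* Multiplicative (ADivisor L) :=
    Algebra.GrothendieckGroup.lift (κ.comp θ)
  have Θ_of : ∀ a : hM.Rlf, Θ (Algebra.GrothendieckGroup.of a) = κ (θ a) := fun a =>
    DFunLike.congr_fun (Algebra.GrothendieckGroup.lift.symm_apply_apply (κ.comp θ)) a
  refine ⟨Θ, ?_, ?_, ?_, ?_⟩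
  · -- injective
    rw [injective_iff_map_eq_one]
    intro z hz
    obtain ⟨a, b, rfl⟩ := IsPerfFactorial.Rlf.gp_exists_eq_div hM z
    rw [map_div, Θ_of, Θ_of, div_eq_one] at hz
    rw [κ_injective.comp (theta_injective j hj₁ hj₂ θ hθ) hz, div_self']
  · -- on `ι(D)`
    intro D
    rw [Θ_of, theta_iota j θ hθ]
    apply Multiplicative.toAdd.injective
    rw [toAdd_ofAdd]
    ext (w | v)
    · rw [κ_apply, hj₁, ADivisor.ofArithDivisor_apply_inl, EffArithDivisor.toArithDivisor_snd, NNReal.coe_mul,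
        NNReal.coe_natCast]
    · rw [κ_apply, hj₂, ADivisor.ofArithDivisor_apply_inr, EffArithDivisor.toArithDivisor_fst, NNReal.coe_natCast,
        Int.cast_natCast]
  · -- effectivity on `Φ(L)^rlf`
    intro a p
    rw [Θ_of, κ_apply]
    exact NNReal.coe_nonneg _
  · -- `ℝ`-linearity
    intro r
    -- both sides are homomorphisms in `ξ`; compare on generators `[a]`, `a ∈ Φ(L)^rlf`
    suffices h : Θ.comp (IsPerfFactorial.Rlf.realSMul hM r) =
        ((DistribSMul.toAddMonoidHom (ADivisor L) r).toMultiplicative).comp Θ from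
      fun ξ => DFunLike.congr_fun h ξ
    refine MonGp.hom_ext fun a => ?_
    have hpow : ∀ (s : ℝ≥0), Θ (Algebra.GrothendieckGroup.of (IsPerfFactorial.Rlf.rpow hM s a)) =
        Multiplicative.ofAdd ((s : ℝ) • Multiplicative.toAdd (Θ (Algebra.GrothendieckGroup.of a))) := by
      intro s
      apply Multiplicative.toAdd.injective
      rw [toAdd_ofAdd, Θ_of, Θ_of]
      ext p
      rw [κ_apply, Finsupp.smul_apply, κ_apply, toAdd_theta_rpow θ, NNReal.coe_mul, smul_eq_mul]
    rw [MonoidHom.comp_apply, MonoidHom.comp_apply, IsPerfFactorial.Rlf.realSMul_of, map_div, hpow, hpow]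
    apply Multiplicative.toAdd.injective
    rw [toAdd_div, toAdd_ofAdd, toAdd_ofAdd, AddMonoidHom.toMultiplicative_apply_apply,
      DistribSMul.toAddMonoidHom_apply, toAdd_ofAdd, ← sub_smul, Real.coe_toNNReal', Real.coe_toNNReal',
      max_zero_sub_max_neg_zero_eq_self]

end ArithRlfCoord

end Literature.AlgebraicGeometry.Frobenioids

end
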